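import Summits.NavierStokesRegularity.FunctionalMining.BiaxialEikonalObstruction
import HarnessLib

/-!
# FunctionalMining — the Saint-Venant contraction `J(Q; w)` and its vanishing on symmetric gradients
# (THEOREM R of `SIEVELD.md` §3.4b (4e), step (i), first half: `inc(sym ∇v) = 0` in the one scalar
# contraction that the biaxial axis identity uses; every dimension, no Levi-Civita symbols)

Search for candidate a priori estimates; no regularity claim. Cell `pub-nsfunc`, prove seat (gen 20).
Static calculus of smooth fields on the flat torus; nothing about Navier–Stokes dynamics.

For a matrix field `Q : T^d → Matrix d d ℝ` with smooth entries and a weight vector `w ∈ ℝ^d` put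
(`svForm Q w x`, all derivatives `∂∂_{ab} f := ∂_a(∂_b f)` of the real entry functions at `x`)

  `J(Q; w) := ∑ᵢⱼ wᵢwⱼ [ 2∑ₖ ∂∂_{ik} Q_{jk} − ∑ₖ ∂∂_{kk} Q_{ij} − ∂∂_{ij} tr Q ] + |w|² [ Δ tr Q − ∑ₖₗ ∂∂_{kl} Q_{kl} ]`.

In dimension three `J(Q; w) = wᵀ·inc(Q)·w` with `inc Q = curl (curl Q)ᵀ` the Saint-Venant incompatibility
operator (expand `ε_{ikl}ε_{jmn}` in Kronecker deltas); the displayed `ε`-free form makes sense in every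
dimension and is what this file works with. MAIN RESULT (`svForm_torusStrainMatrix_eq_zero`): **for every
smooth field `v` on `T^d`, every `w` and every `x`, `J(S(v); w)(x) = 0`**, `S(v) = sym ∇v` the strain matrix
(`torusStrainMatrix`). Proof: with `U_l(a,b,c) := ∂_a∂_b∂_c v_l` (fully symmetric in `a,b,c`: mixed partials
commute, `Torus.partialDeriv_comm`) the bracket is `B_{ij} = ½(Y_{ij} − Y_{ji})`, `Y_{ij} := ∑ₖ U_j(i,k,k) =
∂ᵢΔvⱼ`, which is antisymmetric and dies against `wᵢwⱼ`, while `Δ tr S − ∑ ∂∂_{kl}S_{kl} = Δ div v − Δ div v = 0`.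
Used by `BiaxialTwistFree.lean`: for a biaxial strain `S(v) = m(1 − 3n⊗n)` linearity gives `J(n⊗n; ·) = 0`,
and with `w = n(x)` the left side is a first-order expression in `∇n` (`BiaxialAxisCalculus.lean`) — the
identity `nᵀ inc(n⊗n) n = −2[σ₂(∇n) − (n·curl n)²]` of SIEVELD §3.4b (4e)(i) (two-party at paper level:
census-2 INC-IDENTITY-B). Also: `svForm_affine` (`J` of `c + r·P` is `r·J(P)`). [ours = assembly; folklore =
Saint-Venant compatibility]
-/

noncomputable section

open MeasureTheory Set Filter Topology

namespace Summit.NavierStokesRegularity.FunctionalMining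
open Literature.Analysis Literature.Analysis.FunctionSpaces Literature.Analysis.FunctionSpaces.Torus
  Literature.Analysis.FluidPDE

namespace BiaxialEikonal

variable {d : Type*} [Fintype d] [DecidableEq d]

/-! ## 1. Second partials of real functions and the contraction `J` -/

/-- `∂∂_{ab} f (x) := ∂_a (∂_b f)(x)` for a real function on the torus. [folklore; notation] -/
def dd (a b : d) (f : UnitAddTorus d → ℝ) (x : UnitAddTorus d) : ℝ :=
  Torus.partialDeriv a (Torus.partialDeriv b f) x

/-- The `(i,j)` entry of a matrix field as a real function. [folklore; notation] -/
def entryFun (Q : UnitAddTorus d → Matrix d d ℝ) (i j : d) : UnitAddTorus d → ℝ := fun x => Q x i j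

/-- **The Saint-Venant contraction** `J(Q; w)(x)` (module docstring): the `ε`-free form of `wᵀ inc(Q) w`.
[ours; bookkeeping] -/
def svForm (Q : UnitAddTorus d → Matrix d d ℝ) (w : d → ℝ) (x : UnitAddTorus d) : ℝ :=
  (∑ i, ∑ j, w i * w j * (2 * ∑ k, dd i k (entryFun Q j k) x - ∑ k, dd k k (entryFun Q i j) x
      - ∑ l, dd i j (entryFun Q l l) x))
    + (∑ i, w i ^ 2) * (∑ k, ∑ l, dd k k (entryFun Q l l) x - ∑ k, ∑ l, dd k l (entryFun Q k l) x)

/-- `∂∂_{ab}` of a constant-plus-multiple: if `f = c + r·g` pointwise with `g` smooth then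
`∂∂_{ab} f = r·∂∂_{ab} g`. [folklore] -/
theorem dd_const_add_mul {f g : UnitAddTorus d → ℝ} (hg : Torus.IsSmooth g) (c r : ℝ)
    (hfg : ∀ y, f y = c + r * g y) (a b : d) (x : UnitAddTorus d) : dd a b f x = r * dd a b g x := by
  have hf : f = (fun _ => c) + r • g := funext fun y => by simp [hfg y, smul_eq_mul]
  have h1 : Torus.partialDeriv b f = r • Torus.partialDeriv b g := by
    rw [hf, partialDeriv_add (isContDiff_const c) ((hg.smul r).isContDiff (by simp)),
      partialDeriv_const_smul (hg.isContDiff (by simp))]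
    funext y
    simp [Torus.partialDeriv, Torus.lineDeriv]
  unfold dd
  rw [h1, partialDeriv_const_smul ((hg.partialDeriv b).isContDiff (by simp))]
  rfl

/-- `J` of an affine image: if `Q(y)ᵢⱼ = cᵢⱼ + r·P(y)ᵢⱼ` with `P` smooth entrywise, then
`J(Q; w) = r·J(P; w)`. [ours; bookkeeping] -/
theorem svForm_affine {Q P : UnitAddTorus d → Matrix d d ℝ} (hP : ∀ i j, Torus.IsSmooth (entryFun P i j))
    (c : Matrix d d ℝ) (r : ℝ) (hQP : ∀ y i j, Q y i j = c i j + r * P y i j) (w : d → ℝ)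
    (x : UnitAddTorus d) : svForm Q w x = r * svForm P w x := by
  have hdd : ∀ a b i j, dd a b (entryFun Q i j) x = r * dd a b (entryFun P i j) x := fun a b i j =>
    dd_const_add_mul (hP i j) (c i j) r (fun y => hQP y i j) a b x
  unfold svForm
  simp only [hdd]
  have h1 : ∀ i j, (2 * ∑ k, r * dd i k (entryFun P j k) x - ∑ k, r * dd k k (entryFun P i j) x
      - ∑ l, r * dd i j (entryFun P l l) x) = r * (2 * ∑ k, dd i k (entryFun P j k) x
      - ∑ k, dd k k (entryFun P i j) x - ∑ l, dd i j (entryFun P l l) x) := by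
    intro i j
    rw [← Finset.mul_sum, ← Finset.mul_sum, ← Finset.mul_sum]
    ring
  have h2 : (∑ k, ∑ l, r * dd k k (entryFun P l l) x - ∑ k, ∑ l, r * dd k l (entryFun P k l) x) =
      r * (∑ k, ∑ l, dd k k (entryFun P l l) x - ∑ k, ∑ l, dd k l (entryFun P k l) x) := by
    simp only [← Finset.mul_sum]
    ring
  simp only [h1, h2]
  rw [mul_add, Finset.mul_sum]
  congr 1
  · refine Finset.sum_congr rfl fun i _ => ?_
    rw [Finset.mul_sum]
    exact Finset.sum_congr rfl fun j _ => by ring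
  · ring

/-- Mixed partials commute at function level. [folklore] -/
theorem partialDeriv_comm_fun {F : Type*} [NormedAddCommGroup F] [NormedSpace ℝ F]
    {f : UnitAddTorus d → F} (hf : Torus.IsSmooth f) (a b : d) :
    Torus.partialDeriv a (Torus.partialDeriv b f) = Torus.partialDeriv b (Torus.partialDeriv a f) :=
  funext fun x => partialDeriv_comm hf a b x

/-! ## 2. Third derivatives of a smooth field and their symmetry -/

section ThirdDerivatives

variable {v : UnitAddTorus d → EuclideanSpace ℝ d} (hv : Torus.IsSmooth v)
include hv

/-- Symmetry of `∂_a∂_b∂_c v` in the inner pair. [folklore] -/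
theorem d3_swap_inner (a b c : d) (x : UnitAddTorus d) :
    Torus.partialDeriv a (Torus.partialDeriv b (Torus.partialDeriv c v)) x =
      Torus.partialDeriv a (Torus.partialDeriv c (Torus.partialDeriv b v)) x := by
  rw [partialDeriv_comm_fun hv b c]

/-- Symmetry of `∂_a∂_b∂_c v` in the outer pair. [folklore] -/
theorem d3_swap_outer (a b c : d) (x : UnitAddTorus d) :
    Torus.partialDeriv a (Torus.partialDeriv b (Torus.partialDeriv c v)) x =
      Torus.partialDeriv b (Torus.partialDeriv a (Torus.partialDeriv c v)) x :=
  partialDeriv_comm (hv.partialDeriv c) a b x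

/-- Symmetry of `∂_a∂_b∂_c v` in the first and last slot. [folklore] -/
theorem d3_swap_13 (a b c : d) (x : UnitAddTorus d) :
    Torus.partialDeriv a (Torus.partialDeriv b (Torus.partialDeriv c v)) x =
      Torus.partialDeriv c (Torus.partialDeriv b (Torus.partialDeriv a v)) x := by
  rw [d3_swap_inner hv, d3_swap_outer hv, d3_swap_inner hv]

/-- Second partials of a strain entry in third derivatives of the field:
`∂∂_{ab} S(v)ᵢⱼ = ½((∂_a∂_b∂_j v)ᵢ + (∂_a∂_b∂_i v)ⱼ)`. [folklore] -/
theorem dd_strain (a b i j : d) (x : UnitAddTorus d) :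
    dd a b (entryFun (torusStrainMatrix v) i j) x =
      (Torus.partialDeriv a (Torus.partialDeriv b (Torus.partialDeriv j v)) x i +
        Torus.partialDeriv a (Torus.partialDeriv b (Torus.partialDeriv i v)) x j) / 2 := by
  have hc : ∀ l m : d, Torus.IsSmooth (fun y => Torus.partialDeriv l v y m) :=
    fun l m => (hv.partialDeriv l).apply m
  have hfun : entryFun (torusStrainMatrix v) i j =
      (1 / 2 : ℝ) • ((fun y => Torus.partialDeriv j v y i) + fun y => Torus.partialDeriv i v y j) := by
    funext y
    simp only [entryFun, torusStrainMatrix_apply, Pi.smul_apply, Pi.add_apply, smul_eq_mul]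
    ring
  -- first derivative
  have h1 : Torus.partialDeriv b (entryFun (torusStrainMatrix v) i j) =
      (1 / 2 : ℝ) • ((fun y => Torus.partialDeriv b (Torus.partialDeriv j v) y i) +
        fun y => Torus.partialDeriv b (Torus.partialDeriv i v) y j) := by
    rw [hfun, partialDeriv_const_smul (((hc j i).add (hc i j)).isContDiff (by simp)),
      partialDeriv_add ((hc j i).isContDiff (by simp)) ((hc i j).isContDiff (by simp))]
    congr 1
    funext y
    simp only [Pi.add_apply]
    rw [partialDeriv_apply_coord ((hv.partialDeriv j).isContDiff (by simp)),
      partialDeriv_apply_coord ((hv.partialDeriv i).isContDiff (by simp))]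
  have hc2 : ∀ l m p : d, Torus.IsSmooth (fun y => Torus.partialDeriv l (Torus.partialDeriv m v) y p) :=
    fun l m p => ((hv.partialDeriv m).partialDeriv l).apply p
  unfold dd
  rw [h1, partialDeriv_const_smul (((hc2 b j i).add (hc2 b i j)).isContDiff (by simp)),
    partialDeriv_add ((hc2 b j i).isContDiff (by simp)) ((hc2 b i j).isContDiff (by simp))]
  simp only [Pi.smul_apply, Pi.add_apply, smul_eq_mul]
  rw [partialDeriv_apply_coord (((hv.partialDeriv j).partialDeriv b).isContDiff (by simp)),
    partialDeriv_apply_coord (((hv.partialDeriv i).partialDeriv b).isContDiff (by simp))]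
  ring

/-! ## 3. `J(S(v); w) = 0` -/

/-- The bracket of `J` on a strain is antisymmetric: with `Yᵢⱼ := ∑ₖ (∂ᵢ∂ₖ∂ₖ v)ⱼ = ∂ᵢ(Δv)ⱼ`,
`2∑ₖ ∂∂_{ik}Sⱼₖ − ∑ₖ ∂∂_{kk}Sᵢⱼ − ∂∂_{ij} tr S = ½(Yᵢⱼ − Yⱼᵢ)`. [folklore] -/
theorem svBracket_strain (i j : d) (x : UnitAddTorus d) :
    2 * ∑ k, dd i k (entryFun (torusStrainMatrix v) j k) x - ∑ k, dd k k (entryFun (torusStrainMatrix v) i j) x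
      - ∑ l, dd i j (entryFun (torusStrainMatrix v) l l) x =
      ((∑ k, Torus.partialDeriv i (Torus.partialDeriv k (Torus.partialDeriv k v)) x j) -
        ∑ k, Torus.partialDeriv j (Torus.partialDeriv k (Torus.partialDeriv k v)) x i) / 2 := by
  simp only [dd_strain hv]
  -- normalise every third derivative to the form `∂_a ∂_k ∂_k v` or `∂_i ∂_j ∂_l v`
  have e1 : ∀ k, Torus.partialDeriv i (Torus.partialDeriv k (Torus.partialDeriv j v)) x k =
      Torus.partialDeriv i (Torus.partialDeriv j (Torus.partialDeriv k v)) x k := fun k => by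
    rw [d3_swap_inner hv]
  have e2 : ∀ k, Torus.partialDeriv k (Torus.partialDeriv k (Torus.partialDeriv j v)) x i =
      Torus.partialDeriv j (Torus.partialDeriv k (Torus.partialDeriv k v)) x i := fun k => by
    rw [d3_swap_13 hv]
  have e3 : ∀ k, Torus.partialDeriv k (Torus.partialDeriv k (Torus.partialDeriv i v)) x j =
      Torus.partialDeriv i (Torus.partialDeriv k (Torus.partialDeriv k v)) x j := fun k => by
    rw [d3_swap_13 hv]
  simp only [e1, e2, e3, Finset.mul_sum, Finset.sum_div, ← Finset.sum_sub_distrib]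
  exact Finset.sum_congr rfl fun k _ => by ring

/-- The trace bracket of `J` vanishes on a strain: `Δ tr S(v) − ∑ₖₗ ∂∂_{kl} S(v)ₖₗ = 0`
(`= Δ div v − Δ div v`). [folklore] -/
theorem svTrace_strain (x : UnitAddTorus d) :
    ∑ k, ∑ l, dd k k (entryFun (torusStrainMatrix v) l l) x -
      ∑ k, ∑ l, dd k l (entryFun (torusStrainMatrix v) k l) x = 0 := by
  have h1 : ∑ k, ∑ l, dd k k (entryFun (torusStrainMatrix v) l l) x =
      ∑ k, ∑ l, (Torus.partialDeriv k (Torus.partialDeriv k (Torus.partialDeriv l v)) x l +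
        Torus.partialDeriv k (Torus.partialDeriv k (Torus.partialDeriv l v)) x l) / 2 :=
    Finset.sum_congr rfl fun k _ => Finset.sum_congr rfl fun l _ => by rw [dd_strain hv]
  have h2 : ∑ k, ∑ l, dd k l (entryFun (torusStrainMatrix v) k l) x =
      ∑ k, ∑ l, (Torus.partialDeriv l (Torus.partialDeriv l (Torus.partialDeriv k v)) x k +
        Torus.partialDeriv k (Torus.partialDeriv k (Torus.partialDeriv l v)) x l) / 2 :=
    Finset.sum_congr rfl fun k _ => Finset.sum_congr rfl fun l _ => by
      rw [dd_strain hv, d3_swap_13 hv k l l x, d3_swap_inner hv k l k x]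
  have hc : ∑ k, ∑ l, Torus.partialDeriv l (Torus.partialDeriv l (Torus.partialDeriv k v)) x k =
      ∑ k, ∑ l, Torus.partialDeriv k (Torus.partialDeriv k (Torus.partialDeriv l v)) x l :=
    Finset.sum_comm
  have hsplit : ∀ (A B : d → d → ℝ), ∑ k, ∑ l, (A k l + B k l) / 2 =
      (∑ k, ∑ l, A k l) / 2 + (∑ k, ∑ l, B k l) / 2 := by
    intro A B
    rw [Finset.sum_div, Finset.sum_div, ← Finset.sum_add_distrib]
    refine Finset.sum_congr rfl fun k _ => ?_
    rw [Finset.sum_div, Finset.sum_div, ← Finset.sum_add_distrib]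
    exact Finset.sum_congr rfl fun l _ => by ring
  rw [h1, h2, hsplit, hsplit, hc]
  ring

/-- **`J(S(v); w) = 0`: the Saint-Venant contraction vanishes on every symmetric gradient** (every
smooth `v`, every weight `w`, every point). [folklore: Saint-Venant compatibility `inc(sym∇v) = 0`] -/
theorem svForm_torusStrainMatrix_eq_zero (w : d → ℝ) (x : UnitAddTorus d) :
    svForm (torusStrainMatrix v) w x = 0 := by
  unfold svForm
  rw [svTrace_strain hv, mul_zero, add_zero]
  simp only [svBracket_strain hv]
  -- `∑ᵢⱼ wᵢwⱼ (Yᵢⱼ − Yⱼᵢ)/2 = 0` by the symmetry of `wᵢwⱼ`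
  set Y : d → d → ℝ := fun i j => ∑ k, Torus.partialDeriv i (Torus.partialDeriv k (Torus.partialDeriv k v)) x j
    with hY
  have h : ∑ i, ∑ j, w i * w j * ((Y i j - Y j i) / 2) =
      (∑ i, ∑ j, w i * w j * Y i j) / 2 - (∑ i, ∑ j, w i * w j * Y j i) / 2 := by
    rw [Finset.sum_div, Finset.sum_div, ← Finset.sum_sub_distrib]
    refine Finset.sum_congr rfl fun i _ => ?_
    rw [Finset.sum_div, Finset.sum_div, ← Finset.sum_sub_distrib]
    exact Finset.sum_congr rfl fun j _ => by ring
  have hsymm : ∑ i, ∑ j, w i * w j * Y j i = ∑ i, ∑ j, w i * w j * Y i j := by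
    rw [Finset.sum_comm]
    exact Finset.sum_congr rfl fun i _ => Finset.sum_congr rfl fun j _ => by ring
  change ∑ i, ∑ j, w i * w j * ((Y i j - Y j i) / 2) = 0
  rw [h, hsymm, sub_self]

end ThirdDerivatives

end BiaxialEikonal

end Summit.NavierStokesRegularity.FunctionalMining

end
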